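import Summits.Ventures.PercRepro.RankDistTightSizeLevel

/-!
# PercRepro — THEOREM P FOR AN ARBITRARY UP-SET: the rank level dominates the size level below half the rank,
and the rank distribution dominates the binomial coefficients there (p9, gen 20)

The double counting of `RankDistTightSizeLevel` never used the bottom sets: for ANY finite matroid `M` of rank `p`
and ANY up-closed predicate `P` on the subsets of `E` (`UpClosed M P`), the subsets satisfying `P` with exactly `u`
elements are at most those satisfying `P` with rank `u`, whenever `2u ≤ p` (`card_upSizeLev_le_card_upRankLev`;
stratified by nullity, `card_upSizeLevNull_le_card_upRankLevNull`). With `P = ⊤` this is a statement about the RANK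
DISTRIBUTION `c_u = levelCount M u` of every finite matroid: `C(n, u) ≤ c_u` for `2u ≤ ρ(E)`
(`choose_le_levelCount`) — the number of rank-`u` subsets is at least the number of `u`-subsets below half the rank.
Nothing here moves any window of the crux; it is the general form of a tool of this lane.
-/

namespace PercRepro.RankDist

open Set Finset _root_.Matroid PercRepro.ThmH

variable {α : Type} (M : Matroid α) [M.Finite]

/-- An up-closed predicate on the subsets of `E`: `P A → A ⊆ A' ⊆ E → P A'`. -/
def UpClosed (P : Set α → Prop) : Prop :=
  ∀ A A' : Set α, A' ⊆ M.E → A ⊆ A' → P A → P A'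

open scoped Classical in
/-- The members of the up-set with exactly `k` elements. -/
noncomputable def upSizeLev (P : Set α → Prop) (k : ℕ) : Finset (Set α) :=
  (subsetsFin M).filter (fun A => P A ∧ A.ncard = k)

open scoped Classical in
/-- The members of the up-set of rank `u`. -/
noncomputable def upRankLev (P : Set α → Prop) (u : ℕ) : Finset (Set α) :=
  (subsetsFin M).filter (fun A => P A ∧ rk M A = u)

open scoped Classical in
/-- The members of the up-set with `u` elements and nullity `ν`. -/
noncomputable def upSizeLevNull (P : Set α → Prop) (u ν : ℕ) : Finset (Set α) :=
  (upSizeLev M P u).filter (fun A => rk M A + ν = u)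

open scoped Classical in
/-- The members of the up-set of rank `u` with `u + ν` elements. -/
noncomputable def upRankLevNull (P : Set α → Prop) (u ν : ℕ) : Finset (Set α) :=
  (upRankLev M P u).filter (fun A => A.ncard = u + ν)

open scoped Classical in
/-- Membership in `upSizeLev`. -/
lemma mem_upSizeLev {P : Set α → Prop} {k : ℕ} {A : Set α} :
    A ∈ upSizeLev M P k ↔ A ⊆ M.E ∧ P A ∧ A.ncard = k := by
  unfold upSizeLev
  rw [Finset.mem_filter, mem_subsetsFin]

open scoped Classical in
/-- Membership in `upRankLev`. -/
lemma mem_upRankLev {P : Set α → Prop} {u : ℕ} {A : Set α} :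
    A ∈ upRankLev M P u ↔ A ⊆ M.E ∧ P A ∧ rk M A = u := by
  unfold upRankLev
  rw [Finset.mem_filter, mem_subsetsFin]

open scoped Classical in
/-- Membership in `upSizeLevNull`. -/
lemma mem_upSizeLevNull {P : Set α → Prop} {u ν : ℕ} {A : Set α} :
    A ∈ upSizeLevNull M P u ν ↔ A ∈ upSizeLev M P u ∧ rk M A + ν = u := by
  unfold upSizeLevNull
  rw [Finset.mem_filter]

open scoped Classical in
/-- Membership in `upRankLevNull`. -/
lemma mem_upRankLevNull {P : Set α → Prop} {u ν : ℕ} {A : Set α} :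
    A ∈ upRankLevNull M P u ν ↔ A ∈ upRankLev M P u ∧ A.ncard = u + ν := by
  unfold upRankLevNull
  rw [Finset.mem_filter]

open scoped Classical in
/-- **Every `A` of size `u` and nullity `ν` in the up-set lies below at least `C(p − u + ν, ν)` members of rank `u`
and size `u + ν`**: add `ν` elements of a base through a basis of `A`, taken outside `A`. -/
lemma card_bipartiteAbove_upRankLevNull_ge {P : Set α → Prop} (hP : UpClosed M P) {p u ν : ℕ}
    (hr : M.eRank = (p : ℕ∞)) (hνu : ν ≤ u) (hup : u ≤ p) {A : Set α} (hA : A ∈ upSizeLevNull M P u ν) :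
    (p - u + ν).choose ν ≤ ((upRankLevNull M P u ν).bipartiteAbove (fun A A' => A ⊆ A') A).card := by
  obtain ⟨hA, hrk⟩ := (mem_upSizeLevNull M).1 hA
  obtain ⟨hAE, hPA, hAu⟩ := (mem_upSizeLev M).1 hA
  have hfinA : A.Finite := M.ground_finite.subset hAE
  obtain ⟨I₀, hI₀⟩ := M.exists_isBasis A hAE
  obtain ⟨β, hβ, hI₀β⟩ := hI₀.indep.exists_isBase_superset
  have hβE : β ⊆ M.E := hβ.subset_ground
  have hfinβ : β.Finite := M.ground_finite.subset hβE
  have hI₀card : I₀.ncard = u - ν := by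
    rw [← rk_eq_ncard_of_isBasis M hAE hI₀]; omega
  have hβcard : β.ncard = p := by
    have h := hβ.encard_eq_eRank
    rw [hr, ← hfinβ.cast_ncard_eq] at h
    exact_mod_cast h
  have hβA : (β ∩ A).ncard = u - ν := by
    have h1 : I₀ ⊆ β ∩ A := Set.subset_inter hI₀β hI₀.subset
    have h2 : (β ∩ A).ncard ≤ u - ν := by
      have h := (hβ.indep.subset (Set.inter_subset_left (s := β) (t := A))).encard_le_eRk_of_subset
        (Set.inter_subset_right (s := β) (t := A))
      rw [eRk_eq_coe_rk M hAE, ← (hfinβ.subset Set.inter_subset_left).cast_ncard_eq] at h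
      have h' : (β ∩ A).ncard ≤ rk M A := by exact_mod_cast h
      omega
    have h3 : u - ν ≤ (β ∩ A).ncard := by
      rw [← hI₀card]; exact Set.ncard_le_ncard h1 (hfinβ.subset Set.inter_subset_left)
    omega
  set J : Set α := β \ A with hJ
  have hJcard : J.ncard = p - u + ν := by
    rw [hJ]
    have h := Set.ncard_inter_add_ncard_sdiff_eq_ncard β A hfinβ
    rw [hβA, hβcard] at h
    omega
  have hfinJ : J.Finite := hfinβ.subset Set.sdiff_subset
  have hmaps : ∀ X ∈ {X | X ⊆ J ∧ X.ncard = ν},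
      A ∪ X ∈ (((upRankLevNull M P u ν).bipartiteAbove (fun A A' => A ⊆ A') A : Finset (Set α)) :
        Set (Set α)) := by
    intro X hX
    obtain ⟨hXJ, hXν⟩ := hX
    have hXA : Disjoint X A := Set.disjoint_of_subset_left hXJ Set.disjoint_sdiff_left
    have hXβ : X ⊆ β := hXJ.trans Set.sdiff_subset
    have hXE : X ⊆ M.E := hXβ.trans hβE
    have hfinX : X.Finite := hfinJ.subset hXJ
    have hAXE : A ∪ X ⊆ M.E := Set.union_subset hAE hXE
    rw [Finset.mem_coe, Finset.bipartiteAbove, Finset.mem_filter, mem_upRankLevNull, mem_upRankLev]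
    refine ⟨⟨⟨hAXE, hP A (A ∪ X) hAXE Set.subset_union_left hPA, ?_⟩, ?_⟩, Set.subset_union_left⟩
    · have hle : M.eRk (A ∪ X) ≤ (u : ℕ∞) := by
        calc M.eRk (A ∪ X) ≤ M.eRk A + M.eRk X := M.eRk_union_le_eRk_add_eRk A X
          _ ≤ M.eRk A + X.encard := by gcongr; exact M.eRk_le_encard X
          _ = (u : ℕ∞) := by
            rw [eRk_eq_coe_rk M hAE, ← hfinX.cast_ncard_eq, hXν]
            exact_mod_cast hrk
      have hge : (u : ℕ∞) ≤ M.eRk (A ∪ X) := by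
        have hind : M.Indep (I₀ ∪ X) := hβ.indep.subset (Set.union_subset hI₀β hXβ)
        have hdisj : Disjoint I₀ X := Set.disjoint_of_subset_left hI₀.subset hXA.symm
        have h := hind.encard_le_eRk_of_subset (Set.union_subset_union_left X hI₀.subset)
        rw [Set.encard_union_eq hdisj, ← (hfinA.subset hI₀.subset).cast_ncard_eq, ← hfinX.cast_ncard_eq,
          hI₀card, hXν] at h
        have h' : ((u - ν + ν : ℕ) : ℕ∞) ≤ M.eRk (A ∪ X) := by exact_mod_cast h
        rwa [Nat.sub_add_cancel hνu] at h'
      have h := le_antisymm hle hge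
      rw [eRk_eq_coe_rk M hAXE] at h
      exact_mod_cast h
    · rw [Set.ncard_union_eq hXA.symm hfinA hfinX, hAu, hXν]
  have hinj : Set.InjOn (fun X => A ∪ X) {X | X ⊆ J ∧ X.ncard = ν} := by
    intro X hX Y hY hXY
    have hXA : Disjoint X A := Set.disjoint_of_subset_left hX.1 Set.disjoint_sdiff_left
    have hYA : Disjoint Y A := Set.disjoint_of_subset_left hY.1 Set.disjoint_sdiff_left
    have h1 : (A ∪ X) \ A = (A ∪ Y) \ A := by simp only at hXY; rw [hXY]
    rwa [Set.union_sdiff_left, Set.union_sdiff_left, hXA.sdiff_eq_left, hYA.sdiff_eq_left] at h1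
  have h := Set.ncard_le_ncard_of_injOn (fun X => A ∪ X) hmaps hinj (Finset.finite_toSet _)
  rwa [Set.ncard_powerset_ncard hfinJ ν, hJcard, Set.ncard_coe_finset] at h

open scoped Classical in
/-- **Every `A'` of rank `u` and size `u + ν` lies above at most `C(u + ν, ν)` sets of size `u`.** -/
lemma card_bipartiteBelow_upSizeLevNull_le {P : Set α → Prop} {u ν : ℕ} {A' : Set α}
    (hA' : A' ∈ upRankLevNull M P u ν) :
    ((upSizeLevNull M P u ν).bipartiteBelow (fun A A' => A ⊆ A') A').card ≤ (u + ν).choose ν := by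
  obtain ⟨hA', hA'card⟩ := (mem_upRankLevNull M).1 hA'
  obtain ⟨hA'E, -, -⟩ := (mem_upRankLev M).1 hA'
  have hfin : A'.Finite := M.ground_finite.subset hA'E
  have hsub : (((upSizeLevNull M P u ν).bipartiteBelow (fun A A' => A ⊆ A') A' : Finset (Set α)) :
      Set (Set α)) ⊆ {t | t ⊆ A' ∧ t.ncard = u} := by
    intro A hA
    rw [Finset.mem_coe, Finset.bipartiteBelow, Finset.mem_filter, mem_upSizeLevNull, mem_upSizeLev] at hA
    exact ⟨hA.2, hA.1.1.2.2⟩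
  have h1 := Set.ncard_le_ncard hsub (hfin.finite_subsets.subset (fun t ht => ht.1))
  rw [Set.ncard_coe_finset] at h1
  have h2 := Set.ncard_powerset_ncard hfin u
  rw [hA'card, Nat.choose_symm_add] at h2
  rw [← h2]
  exact h1

/-- **THEOREM P for an up-set, stratified**: `|L_ν| ≤ |R_ν|` for `ν ≤ u`, `2u ≤ ρ(E)`. -/
theorem card_upSizeLevNull_le_card_upRankLevNull {P : Set α → Prop} (hP : UpClosed M P) {p u ν : ℕ}
    (hr : M.eRank = (p : ℕ∞)) (hνu : ν ≤ u) (hu : 2 * u ≤ p) :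
    (upSizeLevNull M P u ν).card ≤ (upRankLevNull M P u ν).card := by
  classical
  have hdc := Finset.card_mul_le_card_mul (s := upSizeLevNull M P u ν) (t := upRankLevNull M P u ν)
    (fun A A' => A ⊆ A') (fun A hA => card_bipartiteAbove_upRankLevNull_ge M hP hr hνu (by omega) hA)
    (fun A' hA' => card_bipartiteBelow_upSizeLevNull_le M hA')
  have hch : (u + ν).choose ν ≤ (p - u + ν).choose ν := Nat.choose_le_choose ν (by omega)
  have hpos : 0 < (p - u + ν).choose ν := Nat.choose_pos (by omega)
  have h : (upSizeLevNull M P u ν).card * (p - u + ν).choose ν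
      ≤ (upRankLevNull M P u ν).card * (p - u + ν).choose ν :=
    hdc.trans (Nat.mul_le_mul_left _ hch)
  exact Nat.le_of_mul_le_mul_right h hpos

/-- The size level `u` is the disjoint union of its nullity classes `ν ≤ u`. -/
lemma card_upSizeLev_eq_sum (P : Set α → Prop) (u : ℕ) :
    (upSizeLev M P u).card = ∑ ν ∈ Finset.range (u + 1), (upSizeLevNull M P u ν).card := by
  classical
  have hrk : ∀ A ∈ upSizeLev M P u, rk M A ≤ u := by
    intro A hA
    obtain ⟨hAE, -, hAu⟩ := (mem_upSizeLev M).1 hA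
    rw [← hAu]; exact rk_le_ncard M hAE
  rw [Finset.card_eq_sum_card_fiberwise (f := fun A => u - rk M A) (t := Finset.range (u + 1))]
  · refine Finset.sum_congr rfl fun ν hν => ?_
    rw [Finset.mem_range] at hν
    congr 1
    ext A
    rw [mem_upSizeLevNull, Finset.mem_filter]
    constructor
    · rintro ⟨hA, h⟩
      exact ⟨hA, by have := hrk A hA; omega⟩
    · rintro ⟨hA, h⟩
      exact ⟨hA, by omega⟩
  · intro A hA
    rw [Finset.mem_coe] at hA
    simp only [Finset.mem_coe, Finset.mem_range]
    have := hrk A hA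
    omega

/-- The nullity classes of the rank level `u` are disjoint subfamilies of it. -/
lemma sum_card_upRankLevNull_le (P : Set α → Prop) (u : ℕ) (t : Finset ℕ) :
    ∑ ν ∈ t, (upRankLevNull M P u ν).card ≤ (upRankLev M P u).card := by
  classical
  rw [← Finset.card_biUnion]
  · exact Finset.card_le_card (Finset.biUnion_subset.2 fun ν _ => Finset.filter_subset _ _)
  · intro ν₁ _ ν₂ _ hne
    rw [Function.onFun, Finset.disjoint_left]
    intro A h1 h2
    rw [mem_upRankLevNull] at h1 h2
    exact hne (by omega)

/-- **THEOREM P FOR AN ARBITRARY UP-SET**: in a finite matroid of rank `p`, for every up-closed predicate `P` on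
the subsets of `E` and every `u` with `2u ≤ p`, the members of the up-set with exactly `u` elements are at most
its members of rank `u`. -/
theorem card_upSizeLev_le_card_upRankLev {P : Set α → Prop} (hP : UpClosed M P) {p u : ℕ}
    (hr : M.eRank = (p : ℕ∞)) (hu : 2 * u ≤ p) : (upSizeLev M P u).card ≤ (upRankLev M P u).card := by
  rw [card_upSizeLev_eq_sum]
  refine (Finset.sum_le_sum fun ν hν => ?_).trans (sum_card_upRankLevNull_le M P u _)
  rw [Finset.mem_range] at hν
  exact card_upSizeLevNull_le_card_upRankLevNull M hP hr (by omega) hu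

/-! ## The rank distribution dominates the binomial coefficients below half the rank -/

open scoped Classical in
/-- With `P = ⊤` the rank level is `levelCount M u`. -/
lemma card_upRankLev_true (u : ℕ) : (upRankLev M (fun _ => True) u).card = levelCount M u := by
  unfold levelCount
  refine Finset.card_bij (fun A _ => A) (fun A hA => ?_) (fun _ _ _ _ h => h) (fun A hA => ⟨A, ?_, rfl⟩)
  · rw [mem_upRankLev] at hA
    rw [Finset.mem_filter, mem_subsetsFin]
    exact ⟨hA.1, hA.2.2⟩
  · rw [Finset.mem_filter, mem_subsetsFin] at hA
    rw [mem_upRankLev]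
    exact ⟨hA.1, trivial, hA.2⟩

/-- With `P = ⊤` the size level has `C(n, u)` members. -/
lemma card_upSizeLev_true (u : ℕ) : (upSizeLev M (fun _ => True) u).card = ((gr M).card).choose u := by
  classical
  have h : ((upSizeLev M (fun _ => True) u : Finset (Set α)) : Set (Set α)) = {t | t ⊆ M.E ∧ t.ncard = u} := by
    ext A
    rw [Finset.mem_coe, mem_upSizeLev]
    simp only [true_and, Set.mem_setOf_eq]
  have h2 := Set.ncard_powerset_ncard M.ground_finite u
  rw [← h, Set.ncard_coe_finset] at h2
  rw [h2, card_gr]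

/-- **The rank distribution dominates the binomial coefficients below half the rank**: in every finite matroid of
rank `p`, `C(|E|, u) ≤ c_u = #{A ⊆ E : ρ(A) = u}` for every `u` with `2u ≤ p`. -/
theorem choose_le_levelCount {p u : ℕ} (hr : M.eRank = (p : ℕ∞)) (hu : 2 * u ≤ p) :
    ((gr M).card).choose u ≤ levelCount M u := by
  classical
  have hP : UpClosed M (fun _ => True) := fun _ _ _ _ _ => trivial
  have h := card_upSizeLev_le_card_upRankLev M hP hr hu
  rw [card_upSizeLev_true, card_upRankLev_true] at h
  exact h

end PercRepro.RankDist
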